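import Mathlib
import Literature.Analysis.FluidPDE.LoopCirculation
import Summits.NavierStokesRegularity.NavierStokesRegularity.Theses.TautLoopKelvin
import HarnessLib

/-!
# `TautLoopKelvin.TautLoopStatic` — the static taut-loop lemma (item stmt-NavierStokesRegularity-15250)

**Statement.** `v ∈ C²(ℝ³; ℝ³)`, `g > 0`, `γ` a `C¹` loop with `|∮_γ v·dl| ≥ g` whose length
`∫₀¹ ‖γ'‖` EQUALS the infimum of the lengths of all `C¹` loops with `|∮ v·dl| ≥ g` (a taut loop).
Then (i) `(∮_γ v·dl) · (∮_γ Δv·dl) ≤ 0` and (ii) `|∮_γ v·dl| = g`.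

PROOF ("translate and shrink", the item's docstring). Tools: circulation/length under scaling
`γ ↦ c • γ` and translation `γ ↦ γ + a`, `|∮_γ v·dl| ≤ (sup |v∘γ|)·length` (so `length(γ) > 0`),
continuity of `c ↦ ∮_{cγ} v·dl`, dominated differentiation of `τ ↦ ∫₀¹⟪w(γ s + τ e), γ'(s)⟫ ds`.
Minimality forbids any `C¹` loop of length `≤ length(γ)` with `|∮ v·dl| > g` (shrink it by
`c < 1` close to `1`); (ii) is the case `γ' = γ`. For (i), `ψᵢ(τ) = ∮_{γ+τeᵢ} v·dl` is
differentiable with `ψᵢ'` differentiable at `0` and `Σᵢ ψᵢ''(0) = ∮_γ Δv·dl` (the Laplacian is the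
trace of the Hessian, `InnerProductSpace.laplacian_eq_iteratedFDeriv_orthonormalBasis`); if
`C · ∮Δv·dl > 0` some `i` has `C ψᵢ''(0) > 0` and a one-variable lemma gives `C ψᵢ(τ) > C²`, i.e.
`|∮_{γ+τeᵢ} v·dl| > g` at the same length — forbidden.

HONEST FRAMING: an elementary variational lemma about HYPOTHETICAL taut loops; nothing here bears
on the regularity problem itself.
-/

noncomputable section

set_option linter.dupNamespace false

namespace Summit.NavierStokesRegularity.NavierStokesRegularity.Theorems

open MeasureTheory Set Filter Topology Metric Function Literature.Analysis.FluidPDE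
open scoped RealInnerProductSpace

namespace TautLoop

variable {v : EuclideanSpace ℝ (Fin 3) → EuclideanSpace ℝ (Fin 3)}
  {γ : ℝ → EuclideanSpace ℝ (Fin 3)}

/-- The length `∫₀¹ ‖γ'‖` is nonnegative. [folklore] -/
theorem length_nonneg (γ : ℝ → EuclideanSpace ℝ (Fin 3)) :
    0 ≤ ∫ σ in (0:ℝ)..1, ‖deriv γ σ‖ :=
  intervalIntegral.integral_nonneg zero_le_one fun _ _ => norm_nonneg _

/-- The image of `[0, 1]` under a `C¹` loop is bounded. [folklore] -/
theorem exists_norm_le (hγ : IsC1Loop γ) : ∃ R : ℝ, 0 ≤ R ∧ ∀ s ∈ Icc (0:ℝ) 1, ‖γ s‖ ≤ R := by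
  obtain ⟨R, hR⟩ := isCompact_Icc.exists_bound_of_continuousOn
    (hγ.continuous.continuousOn (s := Icc (0:ℝ) 1))
  exact ⟨max R 0, le_max_right _ _, fun s hs => (hR s hs).trans (le_max_left _ _)⟩

/-- **`|∮_γ v·dl| ≤ M · length`** with `M` a bound of `‖v‖` on `γ([0,1])`. [folklore] -/
theorem abs_circulation_le (hγ : IsC1Loop γ) (hv : Continuous v) :
    ∃ M : ℝ, 0 ≤ M ∧ |circulation v γ| ≤ M * ∫ σ in (0:ℝ)..1, ‖deriv γ σ‖ := by
  obtain ⟨M, hM⟩ := isCompact_Icc.exists_bound_of_continuousOn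
    ((hv.comp hγ.continuous).continuousOn (s := Icc (0:ℝ) 1))
  refine ⟨max M 0, le_max_right _ _, ?_⟩
  rw [circulation, ← intervalIntegral.integral_const_mul, ← Real.norm_eq_abs]
  refine intervalIntegral.norm_integral_le_of_norm_le zero_le_one
    (Eventually.of_forall fun s hs => ?_) ?_
  · exact (norm_inner_le_norm _ _).trans (mul_le_mul_of_nonneg_right
      ((hM s (Ioc_subset_Icc_self hs)).trans (le_max_left _ _)) (norm_nonneg _))
  · exact (continuous_const.mul hγ.continuous_deriv.norm).intervalIntegrable _ _

/-- A loop with circulation of modulus `≥ g > 0` has positive length. [folklore] -/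
theorem length_pos (hγ : IsC1Loop γ) (hv : Continuous v) {g : ℝ} (hg : 0 < g)
    (hgc : g ≤ |circulation v γ|) : 0 < ∫ σ in (0:ℝ)..1, ‖deriv γ σ‖ := by
  obtain ⟨M, hM0, hM⟩ := abs_circulation_le hγ hv
  by_contra h
  have h0 : ∫ σ in (0:ℝ)..1, ‖deriv γ σ‖ = 0 := le_antisymm (not_lt.1 h) (length_nonneg γ)
  rw [h0, mul_zero] at hM
  linarith [abs_nonneg (circulation v γ)]

/-! ### Rescaling -/

/-- `deriv (λ • γ) = λ • deriv γ` for a differentiable loop. [folklore] -/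
theorem deriv_smul_loop (hγ : IsC1Loop γ) (c : ℝ) (s : ℝ) :
    deriv (c • γ) s = c • deriv γ s := by
  have h := ((hγ.differentiable s).hasDerivAt).const_smul c
  exact h.deriv

/-- Length of the rescaled loop: `∫‖(λγ)'‖ = λ ∫‖γ'‖` for `λ ≥ 0`. [folklore] -/
theorem length_smul (hγ : IsC1Loop γ) {c : ℝ} (hc : 0 ≤ c) :
    ∫ σ in (0:ℝ)..1, ‖deriv (c • γ) σ‖ = c * ∫ σ in (0:ℝ)..1, ‖deriv γ σ‖ := by
  rw [← intervalIntegral.integral_const_mul]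
  refine intervalIntegral.integral_congr fun s _ => ?_
  simp only [deriv_smul_loop hγ c s, norm_smul, Real.norm_of_nonneg hc]

/-- **Continuity of `λ ↦ ∮_{λγ} v·dl`.** [folklore] -/
theorem continuous_circulation_smul (hγ : IsC1Loop γ) (hv : Continuous v) :
    Continuous fun c : ℝ => circulation v (c • γ) := by
  have e : (fun c : ℝ => circulation v (c • γ)) =
      fun c => ∫ s in (0:ℝ)..1, ⟪v (c • γ s), c • deriv γ s⟫ := by
    funext c
    simp only [circulation, deriv_smul_loop hγ c, Pi.smul_apply]
  rw [e]
  refine intervalIntegral.continuous_parametric_intervalIntegral_of_continuous' ?_ 0 1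
  exact ((hv.comp (continuous_fst.smul (hγ.continuous.comp continuous_snd))).inner
    (continuous_fst.smul (hγ.continuous_deriv.comp continuous_snd)))

/-! ### Translation -/

/-- `deriv (γ + a) = deriv γ`. [folklore] -/
theorem deriv_add_const_loop (a : EuclideanSpace ℝ (Fin 3)) (s : ℝ) :
    deriv (fun s => γ s + a) s = deriv γ s := by
  simp [deriv_add_const]

/-- Length is translation invariant. [folklore] -/
theorem length_add_const (a : EuclideanSpace ℝ (Fin 3)) :
    ∫ σ in (0:ℝ)..1, ‖deriv (fun s => γ s + a) σ‖ = ∫ σ in (0:ℝ)..1, ‖deriv γ σ‖ := by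
  simp_rw [deriv_add_const_loop]

/-- The circulation of the translated loop. [folklore] -/
theorem circulation_add_const (a : EuclideanSpace ℝ (Fin 3)) :
    circulation v (fun s => γ s + a) = ∫ s in (0:ℝ)..1, ⟪v (γ s + a), deriv γ s⟫ := by
  simp only [circulation, deriv_add_const_loop]

/-! ### Differentiation of the translated circulation under the integral sign -/

/-- **Derivative of `τ ↦ ∫₀¹ ⟪w(γ s + τ e), γ'(s)⟫ ds`** for `w ∈ C¹`: it is
`∫₀¹ ⟪Dw(γ s + τ e) e, γ'(s)⟫ ds`, at every `τ` (dominated differentiation: near `τ₀` the points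
`γ s + τ e`, `s ∈ [0,1]`, stay in a compact ball where `Dw` is bounded). [folklore] -/
theorem hasDerivAt_integral_inner_translate {w : EuclideanSpace ℝ (Fin 3) → EuclideanSpace ℝ (Fin 3)}
    (hw : ContDiff ℝ 1 w) (hγ : IsC1Loop γ) (e : EuclideanSpace ℝ (Fin 3)) (τ₀ : ℝ) :
    HasDerivAt (fun τ => ∫ s in (0:ℝ)..1, ⟪w (γ s + τ • e), deriv γ s⟫)
      (∫ s in (0:ℝ)..1, ⟪fderiv ℝ w (γ s + τ₀ • e) e, deriv γ s⟫) τ₀ := by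
  have hwd : Differentiable ℝ w := hw.differentiable one_ne_zero
  have hDc : Continuous (fderiv ℝ w) := hw.continuous_fderiv one_ne_zero
  obtain ⟨R, hR0, hR⟩ := exists_norm_le hγ
  -- a bound of `Dw` on the compact ball of radius `R + (|τ₀| + 1)‖e‖`
  obtain ⟨M, hM⟩ := (isCompact_closedBall (0 : EuclideanSpace ℝ (Fin 3))
    (R + (|τ₀| + 1) * ‖e‖)).exists_bound_of_continuousOn hDc.continuousOn
  -- a bound of `γ'` on `[0,1]`
  obtain ⟨B, hB⟩ := isCompact_Icc.exists_bound_of_continuousOn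
    (hγ.continuous_deriv.continuousOn (s := Icc (0:ℝ) 1))
  have hmem : ∀ s ∈ Icc (0:ℝ) 1, ∀ τ ∈ ball τ₀ 1,
      γ s + τ • e ∈ closedBall (0 : EuclideanSpace ℝ (Fin 3)) (R + (|τ₀| + 1) * ‖e‖) := by
    intro s hs τ hτ
    rw [mem_closedBall, dist_zero_right]
    have hτ' : |τ| ≤ |τ₀| + 1 := by
      have := mem_ball.1 hτ; rw [Real.dist_eq] at this
      have h1 := abs_sub_abs_le_abs_sub τ τ₀
      linarith
    calc ‖γ s + τ • e‖ ≤ ‖γ s‖ + ‖τ • e‖ := norm_add_le _ _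
      _ ≤ R + (|τ₀| + 1) * ‖e‖ := by
          rw [norm_smul, Real.norm_eq_abs]
          exact add_le_add (hR s hs) (mul_le_mul_of_nonneg_right hτ' (norm_nonneg _))
  rw [intervalIntegral.integral_of_le zero_le_one]
  simp_rw [intervalIntegral.integral_of_le zero_le_one]
  have key := hasDerivAt_integral_of_dominated_loc_of_deriv_le
    (μ := volume.restrict (Ioc (0:ℝ) 1)) (F := fun τ s => ⟪w (γ s + τ • e), deriv γ s⟫)
    (F' := fun τ s => ⟪fderiv ℝ w (γ s + τ • e) e, deriv γ s⟫) (x₀ := τ₀)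
    (bound := fun _ => M * ‖e‖ * B) (ball_mem_nhds τ₀ one_pos) ?_ ?_ ?_ ?_ ?_ ?_
  · exact key.2
  · -- measurability of `F τ` near `τ₀`
    refine Eventually.of_forall fun τ => ?_
    exact (((hw.continuous.comp (hγ.continuous.add continuous_const)).inner
      hγ.continuous_deriv).aestronglyMeasurable)
  · -- integrability of `F τ₀`
    exact (((hw.continuous.comp (hγ.continuous.add continuous_const)).inner
      hγ.continuous_deriv).integrableOn_Icc (μ := volume) (a := 0) (b := 1)).mono_set
        Ioc_subset_Icc_self
  · -- measurability of `F' τ₀`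
    exact (((hDc.comp (hγ.continuous.add continuous_const)).clm_apply continuous_const).inner
      hγ.continuous_deriv).aestronglyMeasurable
  · -- the bound
    refine (ae_restrict_mem measurableSet_Ioc).mono fun s hs τ hτ => ?_
    have h1 : ‖fderiv ℝ w (γ s + τ • e)‖ ≤ M := hM _ (hmem s (Ioc_subset_Icc_self hs) τ hτ)
    have h2 : ‖deriv γ s‖ ≤ B := hB s (Ioc_subset_Icc_self hs)
    have hM0 : 0 ≤ M := (norm_nonneg _).trans h1
    calc ‖⟪fderiv ℝ w (γ s + τ • e) e, deriv γ s⟫‖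
        ≤ ‖fderiv ℝ w (γ s + τ • e) e‖ * ‖deriv γ s‖ := norm_inner_le_norm _ _
      _ ≤ ‖fderiv ℝ w (γ s + τ • e)‖ * ‖e‖ * ‖deriv γ s‖ := by
          gcongr; exact ContinuousLinearMap.le_opNorm _ _
      _ ≤ M * ‖e‖ * B := by gcongr
  · exact integrableOn_const (by simp [Real.volume_Ioc])
  · -- the pointwise derivative
    refine Eventually.of_forall fun s τ _ => ?_
    have h1 : HasDerivAt (fun τ : ℝ => γ s + τ • e) e τ := by
      simpa using ((hasDerivAt_id τ).smul_const e).const_add (γ s)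
    have h2 : HasDerivAt (fun τ : ℝ => w (γ s + τ • e)) (fderiv ℝ w (γ s + τ • e) e) τ :=
      (hwd (γ s + τ • e)).hasFDerivAt.comp_hasDerivAt τ h1
    have h3 := h2.inner ℝ (hasDerivAt_const τ (deriv γ s))
    simpa using h3

end TautLoop

open MeasureTheory Set Filter Topology Metric Function Literature.Analysis.FluidPDE TautLoop
open scoped RealInnerProductSpace

/-- **One-variable lemma**: if `HasDerivAt h (d τ) τ` for all `τ`, `HasDerivAt d d₂ 0`, and either
`d 0 ≠ 0` or (`d 0 = 0` and `0 < d₂`), then `h 0 < h τ` for some `τ`. [folklore] -/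
theorem TautLoop.exists_gt_of_derivs {h d : ℝ → ℝ} {d₂ : ℝ} (hh : ∀ τ, HasDerivAt h (d τ) τ)
    (hd : HasDerivAt d d₂ 0) (hcase : d 0 ≠ 0 ∨ (d 0 = 0 ∧ 0 < d₂)) : ∃ τ, h 0 < h τ := by
  rcases hcase with hne | ⟨h0, hpos⟩
  · -- first order: the slope of `h` at `0` tends to `d 0 ≠ 0`
    have hsl := (hh 0).tendsto_slope_zero
    rcases lt_or_gt_of_ne hne with hneg | hposd
    · have hev : ∀ᶠ t in 𝓝[≠] (0:ℝ), t⁻¹ • (h (0 + t) - h 0) < d 0 / 2 :=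
        hsl.eventually (gt_mem_nhds (by linarith))
      have hev' : ∀ᶠ t in 𝓝[<] (0:ℝ), t⁻¹ • (h (0 + t) - h 0) < d 0 / 2 ∧ t < 0 :=
        (hev.filter_mono (nhdsWithin_mono _ fun t ht => ne_of_lt ht)).and self_mem_nhdsWithin
      obtain ⟨t, ht, htneg⟩ := hev'.exists
      refine ⟨0 + t, ?_⟩
      rw [smul_eq_mul] at ht
      -- multiply `t⁻¹ (h t - h 0) < d 0 / 2 < 0` by `t < 0`
      have h1 : t * (t⁻¹ * (h (0 + t) - h 0)) > t * (d 0 / 2) := mul_lt_mul_of_neg_left ht htneg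
      rw [← mul_assoc, mul_inv_cancel₀ htneg.ne, one_mul] at h1
      nlinarith
    · have hev : ∀ᶠ t in 𝓝[≠] (0:ℝ), d 0 / 2 < t⁻¹ • (h (0 + t) - h 0) :=
        hsl.eventually (lt_mem_nhds (by linarith))
      have hev' : ∀ᶠ t in 𝓝[>] (0:ℝ), d 0 / 2 < t⁻¹ • (h (0 + t) - h 0) ∧ 0 < t :=
        (hev.filter_mono (nhdsWithin_mono _ fun t ht => ne_of_gt ht)).and self_mem_nhdsWithin
      obtain ⟨t, ht, htpos⟩ := hev'.exists
      refine ⟨0 + t, ?_⟩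
      rw [smul_eq_mul] at ht
      have h1 : t * (d 0 / 2) < t * (t⁻¹ * (h (0 + t) - h 0)) := mul_lt_mul_of_pos_left ht htpos
      rw [← mul_assoc, mul_inv_cancel₀ htpos.ne', one_mul] at h1
      nlinarith
  · -- second order: `d > 0` on a right neighbourhood of `0`, then the mean value theorem
    have hsl := hd.tendsto_slope_zero
    have hev : ∀ᶠ t in 𝓝[≠] (0:ℝ), d₂ / 2 < t⁻¹ • (d (0 + t) - d 0) :=
      hsl.eventually (lt_mem_nhds (by linarith))
    have hev' : ∀ᶠ t in 𝓝[>] (0:ℝ), d₂ / 2 < t⁻¹ • (d (0 + t) - d 0) :=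
      hev.filter_mono (nhdsWithin_mono _ fun t ht => ne_of_gt ht)
    obtain ⟨ε, hε, hεsub⟩ := mem_nhdsGT_iff_exists_Ioo_subset.1 hev'
    have hdpos : ∀ t ∈ Ioo (0:ℝ) ε, 0 < d t := by
      intro t ht
      have h1 : d₂ / 2 < t⁻¹ • (d (0 + t) - d 0) := hεsub ht
      rw [smul_eq_mul, zero_add, h0, sub_zero] at h1
      have h2 : t * (d₂ / 2) < t * (t⁻¹ * d t) := mul_lt_mul_of_pos_left h1 ht.1
      rw [← mul_assoc, mul_inv_cancel₀ ht.1.ne', one_mul] at h2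
      nlinarith [ht.1]
    -- mean value theorem on `[0, ε/2]`
    have hε2 : (0:ℝ) < ε / 2 := by have := mem_Ioi.1 hε; linarith
    obtain ⟨ξ, hξ, hslope⟩ := exists_hasDerivAt_eq_slope h d hε2
      (fun t _ => (hh t).continuousAt.continuousWithinAt) (fun t _ => hh t)
    refine ⟨ε / 2, ?_⟩
    have hdξ : 0 < d ξ := hdpos ξ ⟨hξ.1, by linarith [hξ.2]⟩
    rw [hslope, sub_zero] at hdξ
    have := (div_pos_iff_of_pos_right hε2).1 hdξ
    linarith

/-- **Item stmt-NavierStokesRegularity-15250** (`TautLoopKelvin.TautLoopStatic`): the static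
taut-loop lemma, by "translate and shrink". [cite: MajdaBertozzi2002, §1.6 Prop. 1.11 (circulation of loops)] -/
theorem tautLoopKelvin_tautLoopStatic_proof :
    Summit.NavierStokesRegularity.NavierStokesRegularity.Theses.TautLoopKelvin.TautLoopStatic := by
  unfold Summit.NavierStokesRegularity.NavierStokesRegularity.Theses.TautLoopKelvin.TautLoopStatic
  intro v hv g hg γ hγ hgc hmin
  have hvc : Continuous v := hv.continuous
  have hv1 : ContDiff ℝ 1 v := hv.of_le one_le_two
  -- minimality in real form
  have hminR : ∀ γ' : ℝ → EuclideanSpace ℝ (Fin 3), IsC1Loop γ' → g ≤ |circulation v γ'| →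
      (∫ σ in (0:ℝ)..1, ‖deriv γ σ‖) ≤ ∫ σ in (0:ℝ)..1, ‖deriv γ' σ‖ := by
    intro γ' h1 h2
    have : ENNReal.ofReal (∫ σ in (0:ℝ)..1, ‖deriv γ σ‖) ≤
        ENNReal.ofReal (∫ σ in (0:ℝ)..1, ‖deriv γ' σ‖) := by
      rw [hmin]; exact iInf₂_le γ' ⟨h1, h2⟩
    exact (ENNReal.ofReal_le_ofReal_iff (length_nonneg γ')).1 this
  have hLpos : 0 < ∫ σ in (0:ℝ)..1, ‖deriv γ σ‖ := length_pos hγ hvc hg hgc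
  -- no admissible competitor of length `≤ length γ` with strictly larger circulation
  have hno : ∀ γ' : ℝ → EuclideanSpace ℝ (Fin 3), IsC1Loop γ' → g < |circulation v γ'| →
      (∫ σ in (0:ℝ)..1, ‖deriv γ' σ‖) ≤ (∫ σ in (0:ℝ)..1, ‖deriv γ σ‖) → False := by
    intro γ' h1 h2 h3
    have hcont : Continuous fun c : ℝ => |circulation v (c • γ')| :=
      (continuous_circulation_smul h1 hvc).abs
    have hev : ∀ᶠ c in 𝓝 (1:ℝ), g < |circulation v (c • γ')| := by
      have h := hcont.tendsto 1
      simp only [one_smul] at h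
      exact h.eventually (lt_mem_nhds h2)
    have hev' : ∀ᶠ c in 𝓝[<] (1:ℝ), g < |circulation v (c • γ')| ∧ c ∈ Ioo (0:ℝ) 1 :=
      (hev.filter_mono nhdsWithin_le_nhds).and (Ioo_mem_nhdsLT zero_lt_one)
    obtain ⟨c, hc, hc0, hc1⟩ := hev'.exists
    have h4 := hminR (c • γ') (h1.const_smul c) hc.le
    rw [length_smul h1 hc0.le] at h4
    nlinarith
  refine ⟨?_, ?_⟩
  swap
  · -- (ii) `|∮_γ v·dl| = g`
    by_contra hne
    exact hno γ hγ (lt_of_le_of_ne hgc (Ne.symm hne)) le_rfl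
  -- (i) the sign condition, by contradiction
  by_contra hP
  push Not at hP
  set C : ℝ := circulation v γ with hCdef
  have hCne : C ≠ 0 := by
    intro h0; rw [h0, abs_zero] at hgc; linarith
  -- the basis directions and the translated circulations
  set e : Fin 3 → EuclideanSpace ℝ (Fin 3) := fun i => EuclideanSpace.basisFun (Fin 3) ℝ i with he
  set ψ : Fin 3 → ℝ → ℝ := fun i τ => ∫ s in (0:ℝ)..1, ⟪v (γ s + τ • e i), deriv γ s⟫ with hψ
  set ψ' : Fin 3 → ℝ → ℝ := fun i τ =>
    ∫ s in (0:ℝ)..1, ⟪fderiv ℝ v (γ s + τ • e i) (e i), deriv γ s⟫ with hψ'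
  set ψ'' : Fin 3 → ℝ := fun i =>
    ∫ s in (0:ℝ)..1, ⟪fderiv ℝ (fun x => fderiv ℝ v x (e i)) (γ s + (0:ℝ) • e i) (e i), deriv γ s⟫
    with hψ''
  have hψ0 : ∀ i, ψ i 0 = C := fun i => by simp [hψ, hCdef, circulation]
  have hDψ : ∀ i τ, HasDerivAt (ψ i) (ψ' i τ) τ := fun i τ =>
    hasDerivAt_integral_inner_translate hv1 hγ (e i) τ
  have hw : ∀ i, ContDiff ℝ 1 (fun x => fderiv ℝ v x (e i)) := fun i =>
    (hv.fderiv_right (m := 1) (by norm_num)).clm_apply contDiff_const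
  have hDψ' : ∀ i, HasDerivAt (ψ' i) (ψ'' i) 0 := fun i =>
    hasDerivAt_integral_inner_translate (hw i) hγ (e i) 0
  -- `Σᵢ ψᵢ'' = ∮_γ Δv·dl`
  have hvd2 : Differentiable ℝ (fderiv ℝ v) := (hv.fderiv_right (m := 1) (by norm_num)).differentiable
    one_ne_zero
  have hentry : ∀ i y, fderiv ℝ (fun x => fderiv ℝ v x (e i)) y (e i) =
      iteratedFDeriv ℝ 2 v y ![e i, e i] := by
    intro i y
    rw [iteratedFDeriv_two_apply, fderiv_clm_apply (hvd2 y) (differentiableAt_const _)]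
    simp [ContinuousLinearMap.flip_apply]
  have hsum : ∑ i, ψ'' i = ∫ σ in (0:ℝ)..1, ⟪Laplacian.laplacian v (γ σ), deriv γ σ⟫ := by
    -- each `ψᵢ''` as an integral of a continuous function of `s`
    set f : Fin 3 → ℝ → ℝ := fun i s =>
      ⟪fderiv ℝ (fun x => fderiv ℝ v x (e i)) (γ s) (e i), deriv γ s⟫ with hf
    have hψ''f : ∀ i, ψ'' i = ∫ s in (0:ℝ)..1, f i s := fun i => by
      simp only [hψ'', hf, zero_smul, add_zero]
    have hfc : ∀ i, Continuous (f i) := fun i =>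
      ((((hw i).continuous_fderiv one_ne_zero).comp hγ.continuous).clm_apply
        continuous_const).inner hγ.continuous_deriv
    have hfi : ∀ i ∈ (Finset.univ : Finset (Fin 3)), IntervalIntegrable (f i) volume 0 1 :=
      fun i _ => (hfc i).intervalIntegrable 0 1
    simp_rw [hψ''f]
    rw [← intervalIntegral.integral_finsetSum hfi]
    refine intervalIntegral.integral_congr fun s _ => ?_
    have hlap : Laplacian.laplacian v (γ s) = ∑ i, iteratedFDeriv ℝ 2 v (γ s) ![e i, e i] := by
      have := congrFun (InnerProductSpace.laplacian_eq_iteratedFDeriv_orthonormalBasis v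
        (EuclideanSpace.basisFun (Fin 3) ℝ)) (γ s)
      simpa [he] using this
    simp only [hf, hentry]
    rw [hlap, sum_inner]
  -- a direction with `C ψᵢ'' > 0`
  have hpos : (0:ℝ) < ∑ i, C * ψ'' i := by
    rw [← Finset.mul_sum, hsum]; exact hP
  obtain ⟨i, -, hi⟩ := Finset.exists_lt_of_sum_lt
    (by simpa only [Finset.sum_const_zero] using hpos : ∑ _i : Fin 3, (0:ℝ) < ∑ i, C * ψ'' i)
  -- the one-variable lemma for `τ ↦ C ψᵢ τ`
  have hcase : (fun τ => C * ψ' i τ) 0 ≠ 0 ∨ ((fun τ => C * ψ' i τ) 0 = 0 ∧ 0 < C * ψ'' i) := by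
    by_cases h0 : ψ' i 0 = 0
    · exact Or.inr ⟨by simp [h0], hi⟩
    · exact Or.inl (mul_ne_zero hCne h0)
  obtain ⟨τ, hτ⟩ := TautLoop.exists_gt_of_derivs (h := fun τ => C * ψ i τ)
    (d := fun τ => C * ψ' i τ) (d₂ := C * ψ'' i) (fun τ => (hDψ i τ).const_mul C)
    ((hDψ' i).const_mul C) hcase
  -- `|ψᵢ τ| > |C| ≥ g`
  simp only [hψ0] at hτ
  have hbig : g < |ψ i τ| := by
    have h1 : C * ψ i τ ≤ |C| * |ψ i τ| := by rw [← abs_mul]; exact le_abs_self _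
    have h2 : |C| * |C| = C * C := abs_mul_abs_self C
    have h3 : 0 < |C| := abs_pos.2 hCne
    have h4 : |C| < |ψ i τ| := by nlinarith
    exact lt_of_le_of_lt hgc h4
  -- the translated loop is an admissible competitor of the same length
  have hloop : IsC1Loop fun s => γ s + τ • e i := hγ.add_const _
  have hcirc : circulation v (fun s => γ s + τ • e i) = ψ i τ := circulation_add_const _
  refine hno _ hloop (by rw [hcirc]; exact hbig) (le_of_eq ?_)
  exact length_add_const _

end Summit.NavierStokesRegularity.NavierStokesRegularity.Theorems


end
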